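import Literature.Probability.RandomPlanarGeometry.ObliqueRBMWedge
import HarnessLib

/-!
# The Skorokhod lemma for the obliquely reflected Brownian motion in the `π/3` wedge

First (deterministic) layer of the proof of the named fact
`Literature.Probability.RandomPlanarGeometry.LawlerSchrammWerner2001_orbm_uniformHitting`
(`ObliqueRBMWedge.lean`): every solution `(B, Z, ℓ₁, ℓ₂)` of the Skorokhod-form predicate
`IsORBMSixty` is, almost surely, the EXPLICIT functional of the driving planar Brownian motion `B`

  `ℓ₂(t) = sup_{s ≤ t} (−x(B_s))⁺`, `ℓ₁(t) = sup_{s ≤ t} (−y(B_s))⁺`,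
  `Z_t = B_t + ζ ℓ₁(t) + ℓ₂(t)`,

where `x = quadX`, `y = quadY` are the quadrant (oblique) coordinates of `ObliqueRBMWedge.lean`
(`IsWedgeRBM.quad_decomposition`: `x(Z) = x(B) + ℓ₂`, `y(Z) = y(B) + ℓ₁`). This is Skorokhod's
lemma (uniqueness half) applied coordinatewise; it is the remark "Design" of the module docstring
of `ObliqueRBMWedge.lean`, now proved.

## Contents

* `skorokhodBdry b t = ⨆ s ≤ t, max 0 (−b s)` — the Skorokhod boundary term of a path `b`, with
  its order API (`le_skorokhodBdry`, `skorokhodBdry_le_iff`, `skorokhodBdry_nonneg`,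
  `skorokhodBdry_mono`, `skorokhodBdry_zero`).
* `skorokhod_uniqueness` — **Skorokhod's lemma** (uniqueness): if `b` is continuous with
  `b 0 ≥ 0`, `ℓ` is continuous, non-decreasing, `ℓ 0 = 0`, `b + ℓ ≥ 0` and `ℓ` is flat on every
  interval on which `b + ℓ ≠ 0`, then `ℓ = skorokhodBdry b`.
* Wedge geometry in quadrant coordinates: `quadX_nonneg_of_mem_closedWedge`,
  `quadY_nonneg_of_mem_closedWedge`, `mem_wedgeSide₁_iff_quadY_eq_zero`,
  `mem_wedgeSide₂_iff_quadX_eq_zero`, `eq_of_quadX_eq_of_quadY_eq` (the coordinates determine the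
  point: `z = x(z) + y(z) ζ`), the level function on the opposite side
  (`quadX_add_quadY_of_mem_oppositeSide`, `mem_oppositeSide_iff`).
* `IsWedgeRBM.ae_eq_skorokhodBdry` — **every solution of `IsORBMSixty` is the Skorokhod image of
  its driving Brownian motion**: a.s., for all `t`, the two displayed formulas for `ℓ₂, ℓ₁` hold,
  and (`IsWedgeRBM.ae_eq_skorokhodMap`) `Z_t = B_t + ζ ℓ₁(t) + ℓ₂(t)` with these explicit `ℓ`'s.

## References

* A. V. Skorokhod, *Stochastic equations for diffusion processes in a bounded region*, Theory
  Probab. Appl. 6 (1961) — the reflection lemma; textbook form: Revuz–Yor, *Continuous Martingales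
  and Brownian Motion* (1999), Ch. VI, Lemma (2.1) ("Skorokhod's lemma").
* W. Werner, *Random planar curves and Schramm–Loewner evolutions*, LNM 1840 (2004), Ch. 5 §5.1
  (the reflected Brownian motion `Z_t = Z*_t + ∫ u(Z_s) dℓ_s`). [WernerStFlour2004]
* J. Dubédat, Ann. IHP 40 (2004), §2 (the same process, `α = −1` in Varadhan–Williams'
  conventions). [Dubedat2004]
-/

noncomputable section

open MeasureTheory ProbabilityTheory Complex Set Filter
open scoped NNReal Real Topology

namespace Literature.Probability.RandomPlanarGeometry

/-! ### The Skorokhod boundary term of a path -/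

/-- The **Skorokhod boundary term** of a path `b : ℝ≥0 → ℝ`:
`skorokhodBdry b t = sup_{s ≤ t} max 0 (−b s)`, the unique continuous non-decreasing process from
`0` pushing `b` (with `b 0 ≥ 0`) up to a non-negative path and increasing only when that path is
at `0` (Skorokhod's lemma, `skorokhod_uniqueness`). (For a path unbounded below on `[0, t]` the
real supremum is the junk value `0`; this never happens for the continuous paths used here.)
[cite: WernerStFlour2004, Ch. 5 §5.1] -/
def skorokhodBdry (b : ℝ≥0 → ℝ) (t : ℝ≥0) : ℝ :=
  ⨆ s : Iic t, max 0 (-b s)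

variable {b : ℝ≥0 → ℝ}

/-- `[0, t]` is compact in `ℝ≥0`. [folklore] -/
theorem isCompact_Iic_nnreal (t : ℝ≥0) : IsCompact (Iic t) := by
  rw [← Icc_bot]
  exact isCompact_Icc

/-- For a continuous path the family `s ≤ t ↦ max 0 (−b s)` is bounded above. [folklore] -/
theorem bddAbove_range_skorokhod (hb : Continuous b) (t : ℝ≥0) :
    BddAbove (range fun s : Iic t ↦ max 0 (-b s)) := by
  have hc : Continuous fun s ↦ max 0 (-b s) := by fun_prop
  have : BddAbove ((fun s ↦ max 0 (-b s)) '' Iic t) :=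
    ((isCompact_Iic_nnreal t).image hc).bddAbove
  simpa [image_eq_range] using this

/-- `max 0 (−b s) ≤ skorokhodBdry b t` for `s ≤ t` (continuous `b`). [folklore] -/
theorem le_skorokhodBdry (hb : Continuous b) {s t : ℝ≥0} (hst : s ≤ t) :
    max 0 (-b s) ≤ skorokhodBdry b t :=
  le_ciSup_of_le (bddAbove_range_skorokhod hb t) ⟨s, hst⟩ le_rfl

/-- `skorokhodBdry b t ≤ c ↔ ∀ s ≤ t, max 0 (−b s) ≤ c` (continuous `b`). [folklore] -/
theorem skorokhodBdry_le_iff (hb : Continuous b) {t : ℝ≥0} {c : ℝ} :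
    skorokhodBdry b t ≤ c ↔ ∀ s ≤ t, max 0 (-b s) ≤ c := by
  haveI : Nonempty (Iic t) := ⟨⟨t, Set.mem_Iic.2 le_rfl⟩⟩
  rw [skorokhodBdry, ciSup_le_iff (bddAbove_range_skorokhod hb t)]
  exact ⟨fun h s hs ↦ h ⟨s, hs⟩, fun h s ↦ h s s.2⟩

/-- `0 ≤ skorokhodBdry b t` (continuous `b`). [folklore] -/
theorem skorokhodBdry_nonneg (hb : Continuous b) (t : ℝ≥0) : 0 ≤ skorokhodBdry b t :=
  (le_max_left _ _).trans (le_skorokhodBdry hb le_rfl)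

/-- `−b s ≤ skorokhodBdry b t` for `s ≤ t` (continuous `b`). [folklore] -/
theorem neg_le_skorokhodBdry (hb : Continuous b) {s t : ℝ≥0} (hst : s ≤ t) :
    -b s ≤ skorokhodBdry b t :=
  (le_max_right _ _).trans (le_skorokhodBdry hb hst)

/-- `t ↦ skorokhodBdry b t` is non-decreasing (continuous `b`). [folklore] -/
theorem skorokhodBdry_mono (hb : Continuous b) : Monotone (skorokhodBdry b) := by
  intro s t hst
  rw [skorokhodBdry_le_iff hb]
  exact fun r hr ↦ le_skorokhodBdry hb (hr.trans hst)

/-- `skorokhodBdry b 0 = 0` when `b 0 ≥ 0`. [folklore] -/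
theorem skorokhodBdry_zero (hb : Continuous b) (hb0 : 0 ≤ b 0) : skorokhodBdry b 0 = 0 := by
  refine le_antisymm ?_ (skorokhodBdry_nonneg hb 0)
  rw [skorokhodBdry_le_iff hb]
  intro s hs
  rw [nonpos_iff_eq_zero.1 hs]
  exact max_le le_rfl (by linarith)

/-! ### Skorokhod's lemma (uniqueness) -/

/-- **Skorokhod's lemma, uniqueness half.** Let `b` be a continuous path and let
`ℓ` be continuous, non-decreasing, with `ℓ 0 = 0`, such that the pushed path `x = b + ℓ` is
non-negative (so `b 0 ≥ 0`) and `ℓ` is flat on every interval `[s, t]` on which `x` does not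
vanish. Then
`ℓ t = sup_{s ≤ t} max 0 (−b s)` for every `t`. (Proof: `≥` from `ℓ t ≥ ℓ s = x s − b s ≥ −b s`;
`≤` by flatness after the last zero `τ` of `x` before `t`, where `ℓ τ = −b τ`.)
Revuz–Yor (1999), Ch. VI, Lemma (2.1); used implicitly in Werner (2004), Ch. 5 §5.1.
[cite: WernerStFlour2004, Ch. 5 §5.1] -/
theorem skorokhod_uniqueness (hb : Continuous b) {ℓ : ℝ≥0 → ℝ}
    (hℓc : Continuous ℓ) (hℓ0 : ℓ 0 = 0) (hmono : Monotone ℓ) (hnn : ∀ t, 0 ≤ b t + ℓ t)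
    (hflat : ∀ s t : ℝ≥0, s ≤ t → (∀ r ∈ Icc s t, b r + ℓ r ≠ 0) → ℓ t = ℓ s) (t : ℝ≥0) :
    ℓ t = skorokhodBdry b t := by
  refine le_antisymm ?_ ?_
  · by_cases hZ : ∃ s ≤ t, b s + ℓ s = 0
    · -- `τ` = the last zero of `x = b + ℓ` before `t`
      set S : Set ℝ≥0 := {s | s ≤ t ∧ b s + ℓ s = 0} with hS
      have hSne : S.Nonempty := by
        obtain ⟨s, hs, h0⟩ := hZ
        exact ⟨s, hs, h0⟩
      have hSbdd : BddAbove S := ⟨t, fun s hs ↦ hs.1⟩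
      have hSclosed : IsClosed S := by
        have : S = Iic t ∩ (fun s ↦ b s + ℓ s) ⁻¹' {0} := by
          ext s
          simp [hS]
        rw [this]
        exact isClosed_Iic.inter (isClosed_singleton.preimage (hb.add hℓc))
      set τ := sSup S with hτ
      have hτS : τ ∈ S := hSclosed.csSup_mem hSne hSbdd
      have hτt : τ ≤ t := hτS.1
      have hτ0 : b τ + ℓ τ = 0 := hτS.2
      have hℓt : ℓ t = ℓ τ := by
        rcases hτt.eq_or_lt with h | h
        · rw [h]
        · have hconst : ∀ s ∈ Ioc τ t, ℓ s = ℓ t := by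
            intro s hs
            refine (hflat s t hs.2 fun r hr h0 ↦ ?_).symm
            have hrS : r ∈ S := ⟨hr.2, h0⟩
            have hrτ : r ≤ τ := le_csSup hSbdd hrS
            exact absurd (hs.1.trans_le hr.1) (not_lt.2 hrτ)
          have htend : Tendsto ℓ (𝓝[>] τ) (𝓝 (ℓ τ)) :=
            hℓc.continuousAt.continuousWithinAt.tendsto
          have hev : ∀ᶠ s in 𝓝[>] τ, ℓ s = ℓ t := by
            filter_upwards [Ioc_mem_nhdsGT h] with s hs using hconst s hs
          have htend' : Tendsto ℓ (𝓝[>] τ) (𝓝 (ℓ t)) :=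
            (tendsto_congr' hev).2 tendsto_const_nhds
          exact (tendsto_nhds_unique htend' htend)
      rw [hℓt, show ℓ τ = -b τ by linarith]
      exact neg_le_skorokhodBdry hb hτt
    · push Not at hZ
      rw [hflat 0 t bot_le fun r hr ↦ hZ r hr.2, hℓ0]
      exact skorokhodBdry_nonneg hb t
  · rw [skorokhodBdry_le_iff hb]
    intro s hs
    refine max_le ?_ ?_
    · simpa [hℓ0] using hmono (bot_le : (0 : ℝ≥0) ≤ t)
    · have h1 := hnn s
      have h2 := hmono hs
      linarith

/-! ### Wedge geometry in quadrant coordinates -/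

/-- `quadX (r e^{iφ}) = r (cos φ − sin φ / √3)`. [folklore] -/
theorem quadX_polar (r φ : ℝ) :
    quadX ((r : ℂ) * exp ((φ : ℂ) * I)) = r * (Real.cos φ - Real.sin φ / Real.sqrt 3) := by
  simp [quadX, Complex.exp_re, Complex.exp_im]
  ring

/-- `quadY (r e^{iφ}) = 2 r sin φ / √3`. [folklore] -/
theorem quadY_polar (r φ : ℝ) :
    quadY ((r : ℂ) * exp ((φ : ℂ) * I)) = 2 * (r * Real.sin φ) / Real.sqrt 3 := by
  simp [quadY, Complex.exp_re, Complex.exp_im]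

/-- For `0 ≤ φ ≤ π/3`: `sin φ / √3 ≤ cos φ`, with equality iff `φ = π/3`. The inequality.
[folklore] -/
theorem sin_div_sqrt_three_le_cos {φ : ℝ} (h0 : 0 ≤ φ) (h1 : φ ≤ π / 3) :
    Real.sin φ / Real.sqrt 3 ≤ Real.cos φ := by
  have hπ : π / 3 ≤ π / 2 := by linarith [Real.pi_pos]
  have hs : Real.sin φ ≤ Real.sin (π / 3) :=
    Real.sin_le_sin_of_le_of_le_pi_div_two (by linarith [Real.pi_pos]) hπ h1
  have hc : Real.cos (π / 3) ≤ Real.cos φ :=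
    Real.cos_le_cos_of_nonneg_of_le_pi h0 (by linarith [Real.pi_pos]) h1
  rw [Real.sin_pi_div_three] at hs
  rw [Real.cos_pi_div_three] at hc
  have h3 : (0 : ℝ) < Real.sqrt 3 := by positivity
  have h3' : Real.sqrt 3 ^ 2 = 3 := Real.sq_sqrt (by norm_num)
  rw [div_le_iff₀ h3]
  nlinarith

/-- On the closed wedge of opening `π/3`, `quadX ≥ 0`. [folklore] -/
theorem quadX_nonneg_of_mem_closedWedge {z : ℂ} (hz : z ∈ closedWedge (π / 3)) : 0 ≤ quadX z := by
  obtain ⟨r, φ, hr, h0, h1, rfl⟩ := hz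
  rw [quadX_polar]
  exact mul_nonneg hr (sub_nonneg.2 (sin_div_sqrt_three_le_cos h0 h1))

/-- On the closed wedge of opening `π/3`, `quadY ≥ 0`. [folklore] -/
theorem quadY_nonneg_of_mem_closedWedge {z : ℂ} (hz : z ∈ closedWedge (π / 3)) : 0 ≤ quadY z := by
  obtain ⟨r, φ, hr, h0, h1, rfl⟩ := hz
  rw [quadY_polar]
  have : 0 ≤ Real.sin φ := Real.sin_nonneg_of_nonneg_of_le_pi h0 (by linarith [Real.pi_pos])
  positivity

/-- A point is determined by its quadrant coordinates: `z = x(z) + y(z) ζ`. [folklore] -/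
theorem quadX_add_quadY_mul_dirSixty (z : ℂ) :
    ((quadX z : ℝ) : ℂ) + ((quadY z : ℝ) : ℂ) * dirSixty = z := by
  have h3 : Real.sqrt 3 ≠ 0 := by positivity
  rw [dirSixty_eq]
  apply Complex.ext
  · simp [quadX, quadY]
    field_simp
    ring
  · simp [quadX, quadY]
    field_simp

/-- Two points with the same quadrant coordinates are equal. [folklore] -/
theorem eq_of_quadX_eq_of_quadY_eq {z w : ℂ} (hx : quadX z = quadX w) (hy : quadY z = quadY w) :
    z = w := by
  rw [← quadX_add_quadY_mul_dirSixty z, ← quadX_add_quadY_mul_dirSixty w, hx, hy]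

/-- Points of the first side `ℝ₊` have `quadY = 0`. [folklore] -/
theorem quadY_eq_zero_of_mem_wedgeSide₁ {z : ℂ} (hz : z ∈ wedgeSide₁) : quadY z = 0 := by
  obtain ⟨r, -, rfl⟩ := hz
  exact quadY_ofReal r

/-- Points of the second side `ζℝ₊` have `quadX = 0`. [folklore] -/
theorem quadX_eq_zero_of_mem_wedgeSide₂ {z : ℂ} (hz : z ∈ wedgeSide₂ (π / 3)) : quadX z = 0 := by
  obtain ⟨r, -, rfl⟩ := hz
  exact quadX_ofReal_mul_dirSixty r

/-- On the closed wedge, `z ∈ ℝ₊ ↔ quadY z = 0`. [folklore] -/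
theorem mem_wedgeSide₁_iff_quadY_eq_zero {z : ℂ} (hz : z ∈ closedWedge (π / 3)) :
    z ∈ wedgeSide₁ ↔ quadY z = 0 := by
  refine ⟨quadY_eq_zero_of_mem_wedgeSide₁, fun hy ↦ ?_⟩
  refine ⟨quadX z, quadX_nonneg_of_mem_closedWedge hz, ?_⟩
  apply eq_of_quadX_eq_of_quadY_eq
  · rw [quadX_ofReal]
  · rw [quadY_ofReal, hy]

/-- On the closed wedge, `z ∈ ζℝ₊ ↔ quadX z = 0`. [folklore] -/
theorem mem_wedgeSide₂_iff_quadX_eq_zero {z : ℂ} (hz : z ∈ closedWedge (π / 3)) :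
    z ∈ wedgeSide₂ (π / 3) ↔ quadX z = 0 := by
  refine ⟨quadX_eq_zero_of_mem_wedgeSide₂, fun hx ↦ ?_⟩
  refine ⟨quadY z, quadY_nonneg_of_mem_closedWedge hz, ?_⟩
  apply eq_of_quadX_eq_of_quadY_eq
  · rw [hx]
    exact (quadX_ofReal_mul_dirSixty _).symm
  · exact (quadY_ofReal_mul_dirSixty _).symm

/-- Quadrant coordinates of the parametrised opposite side: `x = N(1 − s)`. [folklore] -/
theorem quadX_oppositeSideParam (N s : ℝ) : quadX (oppositeSideParam N s) = N * (1 - s) := by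
  have : oppositeSideParam N s = ((N * (1 - s) : ℝ) : ℂ) + ((N * s : ℝ) : ℂ) * dirSixty := by
    simp only [oppositeSideParam]
    push_cast
    ring
  rw [this, quadX_add, quadX_ofReal, quadX_ofReal_mul_dirSixty, add_zero]

/-- Quadrant coordinates of the parametrised opposite side: `y = N s`. [folklore] -/
theorem quadY_oppositeSideParam (N s : ℝ) : quadY (oppositeSideParam N s) = N * s := by
  have : oppositeSideParam N s = ((N * (1 - s) : ℝ) : ℂ) + ((N * s : ℝ) : ℂ) * dirSixty := by
    simp only [oppositeSideParam]
    push_cast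
    ring
  rw [this, quadY_add, quadY_ofReal, quadY_ofReal_mul_dirSixty, zero_add]

/-- On the opposite side the level `x + y` equals `N`. [folklore] -/
theorem quadX_add_quadY_of_mem_oppositeSide {N : ℝ} {z : ℂ} (hz : z ∈ oppositeSide N) :
    quadX z + quadY z = N := by
  rw [oppositeSide_eq_image] at hz
  obtain ⟨s, -, rfl⟩ := hz
  rw [quadX_oppositeSideParam, quadY_oppositeSideParam]
  ring

/-- **The opposite side is the level set `{x + y = N}` of the closed wedge** (`N > 0`), and a point
of it is `oppositeSideParam N (y / N)`. [folklore] -/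
theorem mem_oppositeSide_iff {N : ℝ} (hN : 0 < N) {z : ℂ} (hz : z ∈ closedWedge (π / 3)) :
    z ∈ oppositeSide N ↔ quadX z + quadY z = N := by
  refine ⟨quadX_add_quadY_of_mem_oppositeSide, fun h ↦ ?_⟩
  have hx := quadX_nonneg_of_mem_closedWedge hz
  have hy := quadY_nonneg_of_mem_closedWedge hz
  rw [oppositeSide_eq_image]
  refine ⟨quadY z / N, ⟨div_nonneg hy hN.le, ?_⟩, ?_⟩
  · rw [div_le_one hN]
    linarith
  · apply eq_of_quadX_eq_of_quadY_eq
    · rw [quadX_oppositeSideParam]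
      field_simp
      linarith
    · rw [quadY_oppositeSideParam]
      field_simp

/-- On the closed wedge, the point of the opposite side with level `N = x + y` is recovered from
its second coordinate: `oppositeSideParam (x + y) (y / (x + y)) = z` (when `x + y ≠ 0`).
[folklore] -/
theorem oppositeSideParam_quad (z : ℂ) (h : quadX z + quadY z ≠ 0) :
    oppositeSideParam (quadX z + quadY z) (quadY z / (quadX z + quadY z)) = z := by
  apply eq_of_quadX_eq_of_quadY_eq
  · rw [quadX_oppositeSideParam]
    field_simp
    ring
  · rw [quadY_oppositeSideParam]
    field_simp

/-! ### Every solution of `IsORBMSixty` is the Skorokhod image of its driving Brownian motion -/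

section Representation

variable {Ω : Type*} [MeasurableSpace Ω] {P : Measure Ω} {B Z : ℝ≥0 → Ω → ℂ}
  {ℓ₁ ℓ₂ : ℝ≥0 → Ω → ℝ}

/-- The driving planar Brownian motion has a.s. continuous paths. [folklore] -/
theorem IsWedgeRBM.ae_continuous_driving {θ : ℝ} {u₁ u₂ : ℂ}
    (h : IsWedgeRBM θ u₁ u₂ B Z ℓ₁ ℓ₂ P) : ∀ᵐ ω ∂P, Continuous (B · ω) := by
  filter_upwards [h.isBrownianComplex.re.cont, h.isBrownianComplex.im.cont] with ω hre him
  have : (B · ω) = fun t ↦ ((B t ω).re : ℂ) + ((B t ω).im : ℂ) * I := by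
    ext t
    exact (Complex.re_add_im _).symm
  rw [this]
  fun_prop

/-- The driving planar Brownian motion starts at `0` a.s. [folklore] -/
theorem IsWedgeRBM.ae_driving_zero {θ : ℝ} {u₁ u₂ : ℂ}
    (h : IsWedgeRBM θ u₁ u₂ B Z ℓ₁ ℓ₂ P) : ∀ᵐ ω ∂P, B 0 ω = 0 := by
  filter_upwards [h.isBrownianComplex.re.eval_zero_ae_eq_zero,
    h.isBrownianComplex.im.eval_zero_ae_eq_zero] with ω hre him
  apply Complex.ext
  · simpa using hre
  · simpa using him

/-- **Every solution of `IsORBMSixty` is the Skorokhod image of its driving Brownian motion**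
(Skorokhod's lemma applied to the two decoupled coordinates `x(Z) = x(B) + ℓ₂ ≥ 0`,
`y(Z) = y(B) + ℓ₁ ≥ 0` of `IsWedgeRBM.quad_decomposition`): almost surely, for all `t`,
`ℓ₂(t) = sup_{s ≤ t} max 0 (−x(B_s))` and `ℓ₁(t) = sup_{s ≤ t} max 0 (−y(B_s))`.
Revuz–Yor (1999) Ch. VI Lemma (2.1); Werner (2004) Ch. 5 §5.1 (the process is determined by its
driving Brownian motion). [cite: WernerStFlour2004, Ch. 5 §5.1] -/
theorem IsWedgeRBM.ae_eq_skorokhodBdry (h : IsORBMSixty B Z ℓ₁ ℓ₂ P) :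
    ∀ᵐ ω ∂P, ∀ t, ℓ₂ t ω = skorokhodBdry (fun s ↦ quadX (B s ω)) t ∧
      ℓ₁ t ω = skorokhodBdry (fun s ↦ quadY (B s ω)) t := by
  filter_upwards [h.quad_decomposition, h.ae_continuous_driving, h.ae_continuous, h.ae_monotone,
    h.ae_flat_off_side, h.ae_skorokhod] with ω hdec hBc hc hmono hflat hsk
  obtain ⟨hZc, hℓ₁c, hℓ₂c⟩ := hc
  obtain ⟨hℓ₁0, hℓ₂0, hℓ₁m, hℓ₂m⟩ := hmono
  obtain ⟨hflat₁, hflat₂⟩ := hflat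
  have hxc : Continuous fun s ↦ quadX (B s ω) := by
    have : Continuous quadX := by unfold quadX; fun_prop
    exact this.comp hBc
  have hyc : Continuous fun s ↦ quadY (B s ω) := by
    have : Continuous quadY := by unfold quadY; fun_prop
    exact this.comp hBc
  intro t
  constructor
  · refine skorokhod_uniqueness hxc hℓ₂c hℓ₂0 hℓ₂m
      (fun s ↦ ?_) (fun s t hst hne ↦ hflat₂ s t hst fun r hr hr₂ ↦ ?_) t
    · rw [← (hdec s).1]
      exact quadX_nonneg_of_mem_closedWedge (hsk s).1
    · exact hne r hr (by rw [← (hdec r).1]; exact quadX_eq_zero_of_mem_wedgeSide₂ hr₂)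
  · refine skorokhod_uniqueness hyc hℓ₁c hℓ₁0 hℓ₁m
      (fun s ↦ ?_) (fun s t hst hne ↦ hflat₁ s t hst fun r hr hr₁ ↦ ?_) t
    · rw [← (hdec s).2]
      exact quadY_nonneg_of_mem_closedWedge (hsk s).1
    · exact hne r hr (by rw [← (hdec r).2]; exact quadY_eq_zero_of_mem_wedgeSide₁ hr₁)

/-- **The reflected process is an explicit functional of the driving Brownian motion**: almost
surely, for all `t`,
`Z_t = B_t + ζ · sup_{s≤t} max 0 (−y(B_s)) + sup_{s≤t} max 0 (−x(B_s))`.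
[cite: WernerStFlour2004, Ch. 5 §5.1] -/
theorem IsWedgeRBM.ae_eq_skorokhodMap (h : IsORBMSixty B Z ℓ₁ ℓ₂ P) :
    ∀ᵐ ω ∂P, ∀ t, Z t ω = B t ω
      + dirSixty * ((skorokhodBdry (fun s ↦ quadY (B s ω)) t : ℝ) : ℂ)
      + ((skorokhodBdry (fun s ↦ quadX (B s ω)) t : ℝ) : ℂ) := by
  filter_upwards [h.ae_eq_skorokhodBdry, h.ae_skorokhod] with ω hω hsk t
  obtain ⟨-, heq⟩ := hsk t
  rw [heq, (hω t).1, (hω t).2, one_mul]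

/-- Quadrant coordinates of the reflected process as explicit functionals of the driving Brownian
motion: a.s., for all `t`, `x(Z_t) = x(B_t) + sup_{s≤t} max 0 (−x(B_s))` and
`y(Z_t) = y(B_t) + sup_{s≤t} max 0 (−y(B_s))` — two one-dimensional reflected paths.
[cite: WernerStFlour2004, Ch. 5 §5.1] -/
theorem IsWedgeRBM.ae_quad_eq (h : IsORBMSixty B Z ℓ₁ ℓ₂ P) :
    ∀ᵐ ω ∂P, ∀ t, quadX (Z t ω) = quadX (B t ω) + skorokhodBdry (fun s ↦ quadX (B s ω)) t ∧
      quadY (Z t ω) = quadY (B t ω) + skorokhodBdry (fun s ↦ quadY (B s ω)) t := by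
  filter_upwards [h.ae_eq_skorokhodBdry, h.quad_decomposition] with ω hω hdec t
  exact ⟨by rw [(hdec t).1, (hω t).1], by rw [(hdec t).2, (hω t).2]⟩

end Representation

end Literature.Probability.RandomPlanarGeometry
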